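import Summits.QuantumFields.YangMills.Theorems.UnitScaleTiltProp7FlatDatum
import Summits.QuantumFields.YangMills.Theorems.UnitScaleTiltMinimiserStabilityRegPrAvgCurvGrad
import HarnessLib

/-!
# Route `UnitScaleTilt`, crux K1 «MinimiserStabilityRegPr» (stmt-QuantumFields-19200), registered stub `stub_prop7From14` (leaf V3 «Prop 7 from a
# background (14)») — **RIGIDITY OF THE FLAT SECTOR: in every (0.4)-fibre the holonomy-flat configurations form at most ONE orbit of print's group
# (4); hence BOTH CLAUSES OF THE REGISTERED TEXT HOLD AT EVERY DATUM WHOSE FIBRE MEETS THE FLAT SECTOR** — for every `ε₀`, `ε₁`, every member;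
# e.g. at the constant abelian data with arbitrary Polyakov phases (§5)

Cell `ym3-torus` ∕ fleet seat `ym-ust-19200-p1` (gen 6).  Generalises the sibling `Prop7FlatDatum` (`V = 1`) and the pure-gauge corollary of
`Prop7OrbitTransport` by making the pure-gauge lemma of `Prop7FlatHolonomy` RELATIVE: two holonomy-flat configurations with the same holonomies along
the torus cycles at a base site differ by a gauge transformation (§1); at the `k`-fold centres, two holonomy-flat configurations with the same `k`-fold
straight segments differ by a gauge transformation TRIVIAL AT THE CENTRES (§2).  At the carrier (§3–§4): two holonomy-flat configurations in one
(0.4)-fibre have the same `(K−n)`-fold average, which for holonomy-flat configurations IS the field of straight segments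
(`Prop7FlatHolonomy.iter_blockAvg_eq_straightIter_of_flat`), so they lie on one (4)-orbit (**`sameOrbit_of_holFlat_of_mem_fibre`**); a holonomy-flat
configuration has trivial plaquettes, zero action and lies in print's regular space `𝔘_k(e)` for EVERY `e > 0` (both clauses of (2): the divergence
clause by the `AvgCurvGrad` dictionary `covDerivT_plaqFT_shift_eq`), so a reading-R2 critical configuration over such a datum has zero action and is
itself holonomy-flat (`Prop7FlatDatum.holFlat_of_plaqHol_eq_one`).  Hence **`atMostOneCriticalOrbit_of_holFlat_mem_fibre`** (clause 1, every `ε₀`)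
and **`onMinimalOrbit_of_holFlat_mem_fibre`** (clause 2, every radius) at every datum `V` whose fibre contains a holonomy-flat configuration; §5: the
constant configurations `U(b) = h^{a(b.dir)}` (`h ∈ SU(2)`, `a : Fin 3 → ℤ`) are holonomy-flat (`holAt = h^{Σ a_ν·netDisp_ν}`), so both clauses hold
at their data `V = D_{n,K}U` — non-pure-gauge data with Polyakov phases `h^{a_ν N₀}` (`prop7_clauses_constAbelianDatum`).  Sorry-free, no definitions,
nothing of Bałaban's analysis used (the flat sector is the degenerate regime of [7]).

References: T. Bałaban, CMP 102 (1985) 277–309 [Balaban1985Variational] ((2)–(6) p.278, Prop. 7 p.299); CMP 99 (1985) 75–102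
[Balaban1985RegularSpaces] ((1.1)–(1.2) p.76, (1.9) p.77); CMP 109 (1987) 249–301 [Balaban1987RG1] ((0.4), (0.11) p.253); CMP 98 (1985) 17–51
[Balaban1985Averaging] ((8)–(9) pp.18–19); I. Montvay, G. Münster, *Quantum fields on a lattice* (1994) (3.124)–(3.125) [MontvayMunster1994].
-/

noncomputable section

namespace Summit.QuantumFields.YangMills.Theorems.Prop7FlatRigidity

open scoped Matrix.Norms.L2Operator
open Literature.MathematicalPhysics.QuantumFieldTheory.Balaban1983to89
open T4Continuum T4ReflectionCone BlockAveraging B15DeterminingSets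
open Literature.MathematicalPhysics.QuantumFieldTheory.Balaban1983to89.T3ContinuumYM3Torus
open Literature.MathematicalPhysics.QuantumFieldTheory.Balaban1983to89.T3LevelShift
open Literature.MathematicalPhysics.QuantumFieldTheory.Balaban1983to89.T3UnitLawDensityEML (ℰp)
open Literature.MathematicalPhysics.QuantumFieldTheory.Balaban1983to89.T3TiltDescent
open Literature.MathematicalPhysics.QuantumFieldTheory.Balaban1983to89.T3ConstrainedMinimiser
open Literature.MathematicalPhysics.QuantumFieldTheory.Balaban1983to89.T3DescentFibreTower
open Literature.MathematicalPhysics.QuantumFieldTheory.Balaban1983to89.T3RegularMinimiser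
open Literature.MathematicalPhysics.QuantumFieldTheory.Balaban1983to89.T3PrintedRegularMinimiser
open Literature.MathematicalPhysics.QuantumFieldTheory.Balaban1983to89.T3PrintedRegularOrbits (descTransf)
open Literature.MathematicalPhysics.QuantumFieldTheory.Balaban1983to89.T3Thm1Carrier
open Literature.MathematicalPhysics.QuantumFieldTheory.Balaban1983to89.T3Thm1CarrierNative
open Literature.MathematicalPhysics.QuantumFieldTheory.Balaban1983to89.T3SectALandauChart (sameOrbit_symm sameOrbit_trans)
open Literature.MathematicalPhysics.QuantumFieldTheory.Balaban1983to89.B10Eq27TorusAxialLog (toUField unitsField)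
open Literature.MathematicalPhysics.QuantumFieldTheory.Balaban1983to89.B10Eq68TorusRegularity (plaqFT covDerivT covDivT)
open Summit.QuantumFields.YangMills.Theorems.Prop7FlatHolonomy
open Summit.QuantumFields.YangMills.Theorems.Prop7FlatDatum

/-! ## §1 The relative pure-gauge lemma on a torus -/

section Relative

variable {P : Params} {j : ℕ} {G : Type*} [GaugeGroup G] (U U' : GaugeField P j G)
  (hflat : ∀ (x : Site P j) (w : List (Letter P.d)), (∀ ν, netDisp w ν = 0) → holAt U (walk x w) = 1)
  (hflat' : ∀ (x : Site P j) (w : List (Letter P.d)), (∀ ν, netDisp w ν = 0) → holAt U' (walk x w) = 1)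
  (x₀ : Site P j)
  (hcyc : ∀ ν, holAt U (walk x₀ (List.replicate (P.sitesPerDir j) (ν, true))) = holAt U' (walk x₀ (List.replicate (P.sitesPerDir j) (ν, true))))
include hcyc

/-- Equal positive axis cycles at `x₀` ⇒ equal holonomy along every run of whole multiples of the period, either orientation. [folklore] -/
theorem holAt_walk_replicate_mul_sitesPerDir_eq (ν : Fin P.d) : ∀ (b : Bool) (a : ℕ),
    holAt U (walk x₀ (List.replicate (a * P.sitesPerDir j) (ν, b))) = holAt U' (walk x₀ (List.replicate (a * P.sitesPerDir j) (ν, b))) := by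
  have hone : ∀ b : Bool,
      holAt U (walk x₀ (List.replicate (P.sitesPerDir j) (ν, b))) = holAt U' (walk x₀ (List.replicate (P.sitesPerDir j) (ν, b))) := by
    have h := holAt_walk_wordRev U x₀ (List.replicate (P.sitesPerDir j) (ν, true))
    have h' := holAt_walk_wordRev U' x₀ (List.replicate (P.sitesPerDir j) (ν, true))
    have hend := walkEnd_replicate_mul_sitesPerDir x₀ (ν, true) 1
    rw [one_mul] at hend
    rw [hend, wordRev_replicate] at h h'
    rintro ⟨_ | _⟩
    · exact h.trans ((congrArg (·⁻¹) (hcyc ν)).trans h'.symm)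
    · exact hcyc ν
  intro b a
  induction a with
  | zero => simp [walk, holAt_nil]
  | succ a ih =>
    rw [Nat.succ_mul, List.replicate_add, holAt_walk_append, holAt_walk_append, walkEnd_replicate_mul_sitesPerDir, ih, hone]

include hflat hflat'

/-- **EQUAL CYCLES ⇒ EQUAL HOLONOMY ALONG EVERY TORUS-CLOSED WORD AT `x₀`** (both configurations holonomy-flat): the compensating staircase of whole
cycles has the same holonomy for both, and the compensated word has zero net displacement. [folklore] -/
theorem holAt_walk_eq_of_walkEnd_eq_self (w : List (Letter P.d)) (hw : walkEnd x₀ w = x₀) : holAt U (walk x₀ w) = holAt U' (walk x₀ w) := by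
  have hdvd : ∀ ν, (P.sitesPerDir j : ℤ) ∣ netDisp w ν := fun ν => by
    have h := congrFun hw ν
    rw [walkEnd_apply] at h
    exact (ZMod.intCast_zmod_eq_zero_iff_dvd _ _).mp (add_eq_left.mp h)
  choose m hm using hdvd
  have hruns : ∀ as : List (Fin P.d),
      holAt U (walk x₀ (stairRuns (fun ν => -netDisp w ν) as)) = holAt U' (walk x₀ (stairRuns (fun ν => -netDisp w ν) as)) ∧
        walkEnd x₀ (stairRuns (fun ν => -netDisp w ν) as) = x₀ := by
    intro as
    induction as with
    | nil => exact ⟨by simp [stairRuns, walk, holAt_nil], rfl⟩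
    | cons a as ih =>
      have hrun : axisRun a (-netDisp w a) = List.replicate ((m a).natAbs * P.sitesPerDir j) (a, decide (0 ≤ -netDisp w a)) := by
        rw [axisRun, hm a, Int.natAbs_neg, Int.natAbs_mul, Int.natAbs_natCast, Nat.mul_comm]
      rw [stairRuns, hrun]
      refine ⟨?_, by rw [walkEnd_append, walkEnd_replicate_mul_sitesPerDir, ih.2]⟩
      rw [holAt_walk_append, holAt_walk_append, walkEnd_replicate_mul_sitesPerDir, ih.1,
        holAt_walk_replicate_mul_sitesPerDir_eq U U' x₀ hcyc a]
  have hC := hruns ((List.finRange P.d).map (1 : Equiv.Perm (Fin P.d)))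
  have hzero : holAt U (walk x₀ (w ++ stairWord 1 (fun ν => -netDisp w ν))) = holAt U' (walk x₀ (w ++ stairWord 1 (fun ν => -netDisp w ν))) := by
    rw [hflat x₀ _ fun ν => by rw [netDisp_append, netDisp_stairWord, add_neg_cancel],
      hflat' x₀ _ fun ν => by rw [netDisp_append, netDisp_stairWord, add_neg_cancel]]
  rw [holAt_walk_append, holAt_walk_append, hw, stairWord, hC.1] at hzero
  exact mul_right_cancel hzero

/-- Two words from `x₀` with the same end site: `U(w₁)U(w₂)⁻¹ = U′(w₁)U′(w₂)⁻¹`. [folklore] -/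
theorem holAt_mul_inv_eq_of_walkEnd_eq {w₁ w₂ : List (Letter P.d)} (h : walkEnd x₀ w₁ = walkEnd x₀ w₂) :
    holAt U (walk x₀ w₁) * (holAt U (walk x₀ w₂))⁻¹ = holAt U' (walk x₀ w₁) * (holAt U' (walk x₀ w₂))⁻¹ := by
  have h1 := holAt_walk_eq_of_walkEnd_eq_self U U' hflat hflat' x₀ hcyc (w₁ ++ wordRev w₂)
    (by rw [walkEnd_append, h, walkEnd_walkEnd_wordRev])
  rwa [holAt_walk_append, holAt_walk_append, h, holAt_walk_wordRev, holAt_walk_wordRev] at h1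

/-- **THE RELATIVE PURE-GAUGE LEMMA**: two holonomy-flat configurations with the same positive axis cycles at `x₀` differ by the gauge transformation
`u(x) = U′(x₀ → x)⁻¹·U(x₀ → x)` (any walk; well defined): `U′ = U^{u}`. [cite: MontvayMunster1994, (3.124)-(3.125) p.120] -/
theorem exists_gaugeAct_eq :
    ∃ u : GaugeTransf P j G, GaugeField.gaugeAct u U = U' ∧
      ∀ (x : Site P j) (w : List (Letter P.d)), walkEnd x₀ w = x → u x = (holAt U' (walk x₀ w))⁻¹ * holAt U (walk x₀ w) := by
  obtain ⟨pw, hpw⟩ : ∃ pw : Site P j → List (Letter P.d), ∀ x, walkEnd x₀ (pw x) = x :=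
    ⟨fun x => stairWord 1 fun ν => (((x ν - x₀ ν).val : ℕ) : ℤ), walkEnd_stairWord_sub x₀⟩
  -- the key relation between two walks with the same end
  have hkey : ∀ (x : Site P j) (w : List (Letter P.d)), walkEnd x₀ w = x →
      (holAt U' (walk x₀ (pw x)))⁻¹ * holAt U (walk x₀ (pw x)) = (holAt U' (walk x₀ w))⁻¹ * holAt U (walk x₀ w) := by
    intro x w hw
    have h1 := holAt_mul_inv_eq_of_walkEnd_eq U U' hflat hflat' x₀ hcyc (w₁ := pw x) (w₂ := w) (by rw [hpw, hw])
    -- `a b⁻¹ = a' b'⁻¹ ⇒ a'⁻¹ a = b'⁻¹ b`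
    have h2 := congrArg (fun g => (holAt U' (walk x₀ (pw x)))⁻¹ * g * holAt U (walk x₀ w)) h1
    simpa only [mul_assoc, inv_mul_cancel, mul_one, inv_mul_cancel_left] using h2
  refine ⟨fun x => (holAt U' (walk x₀ (pw x)))⁻¹ * holAt U (walk x₀ (pw x)), ?_, fun x w hw => hkey x w hw⟩
  funext b
  show (holAt U' (walk x₀ (pw b.src)))⁻¹ * holAt U (walk x₀ (pw b.src)) * U b *
      ((holAt U' (walk x₀ (pw b.tgt)))⁻¹ * holAt U (walk x₀ (pw b.tgt)))⁻¹ = U' b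
  rw [hkey b.tgt (pw b.src ++ [(b.dir, true)]) (by rw [walkEnd_append, hpw]; rfl), holAt_walk_append, holAt_walk_append, hpw,
    holAt_walk_single_true, holAt_walk_single_true]
  group

end Relative

/-! ## §2 At the `k`-fold centres: equal segments ⇒ one orbit of the group (4) -/

section Centres

variable {P : Params} {G : Type*} [GaugeGroup G] (U U' : GaugeField P 0 G) {k : ℕ}
  (hseg : ∀ c : PBond P k, holAt U (walk (embIter k c.src) (List.replicate (P.L ^ k) (c.dir, true))) =
    holAt U' (walk (embIter k c.src) (List.replicate (P.L ^ k) (c.dir, true))))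
include hseg

/-- Equal `k`-fold segments ⇒ equal holonomy along every `L^k`-dilated coarse walk from a `k`-centre (straight-transporter transfer). [cite: Balaban1987RG1, (0.1) p.252] -/
theorem holAt_walk_embIter_flatMap_eq (y : Site P k) (w : List (Letter P.d)) :
    holAt U (walk (embIter k y) (w.flatMap fun l => List.replicate (P.L ^ k) l)) =
      holAt U' (walk (embIter k y) (w.flatMap fun l => List.replicate (P.L ^ k) l)) := by
  rw [← holAt_walk_of_straightIter U k y w, ← holAt_walk_of_straightIter U' k y w]
  have h : (fun c : PBond P k => holAt U (walk (embIter k c.src) (List.replicate (P.L ^ k) (c.dir, true)))) =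
      fun c : PBond P k => holAt U' (walk (embIter k c.src) (List.replicate (P.L ^ k) (c.dir, true))) := funext hseg
  rw [h]

/-- **EQUAL `k`-FOLD SEGMENTS ⇒ ONE ORBIT OF THE GROUP (4)**: two holonomy-flat configurations of the finest torus with the same `k`-fold straight segments
differ by a gauge transformation with `u = 1` at every `k`-fold block centre (standing range `k ≤ m + K`). [cite: Balaban1985Variational, (4) p.278] -/
theorem exists_gaugeAct_eq_of_segments (hk : k ≤ P.m + P.K)
    (hflat : ∀ (x : Site P 0) (w : List (Letter P.d)), (∀ ν, netDisp w ν = 0) → holAt U (walk x w) = 1)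
    (hflat' : ∀ (x : Site P 0) (w : List (Letter P.d)), (∀ ν, netDisp w ν = 0) → holAt U' (walk x w) = 1) :
    ∃ u : GaugeTransf P 0 G, (∀ y : Site P k, u (embIter k y) = 1) ∧ GaugeField.gaugeAct u U = U' := by
  have hcyc : ∀ ν, holAt U (walk (embIter k (0 : Site P k)) (List.replicate (P.sitesPerDir 0) (ν, true))) =
      holAt U' (walk (embIter k (0 : Site P k)) (List.replicate (P.sitesPerDir 0) (ν, true))) := fun ν => by
    rw [sitesPerDir_zero_eq_mul_pow hk, ← flatMap_replicate_replicate]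
    exact holAt_walk_embIter_flatMap_eq U U' hseg 0 _
  obtain ⟨u, hu, huw⟩ := exists_gaugeAct_eq U U' hflat hflat' (embIter k (0 : Site P k)) hcyc
  refine ⟨u, fun y => ?_, hu⟩
  rw [huw (embIter k y) ((stairWord 1 fun ν => (((y ν - (0 : Site P k) ν).val : ℕ) : ℤ)).flatMap fun l => List.replicate (P.L ^ k) l)
    (by rw [walkEnd_embIter_flatMap, walkEnd_stairWord_sub]), holAt_walk_embIter_flatMap_eq U U' hseg, inv_mul_cancel]

end Centres

/-! ## §3 Holonomy-flat `SU(2)` configurations: trivial plaquettes, zero action, printed-regular at every radius -/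

section FlatSU2

variable {P : Params} {s : ℕ}

/-- The plaquette variable is the holonomy of the plaquette word. [cite: Balaban1985Averaging, (9) p.19] -/
theorem plaqHol_eq_holAt_walk_plaqWord {G : Type*} [GaugeGroup G] (U : GaugeField P s G) (p : Plaq P s) :
    GaugeField.plaqHol U p = holAt U (walk p.src (plaqWord p.μ p.ν)) := by
  rw [walk_plaqWord]
  simp [holAt_cons, holAt_nil, GaugeField.plaqHol, mul_assoc]

/-- A holonomy-flat configuration has trivial plaquette variables. [cite: Balaban1985Averaging, (9) p.19] -/
theorem plaqHol_eq_one_of_holFlat {G : Type*} [GaugeGroup G] (U : GaugeField P s G)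
    (hflat : ∀ (x : Site P s) (w : List (Letter P.d)), (∀ ν, netDisp w ν = 0) → holAt U (walk x w) = 1) (p : Plaq P s) :
    GaugeField.plaqHol U p = 1 := by
  rw [plaqHol_eq_holAt_walk_plaqWord]
  exact hflat _ _ (netDisp_plaqWord _ _)

/-- … hence zero Wilson action. [cite: Balaban1987RG1, (0.2) p.252] -/
theorem wilsonAction4_eq_zero_of_holFlat {G : Type*} [GaugeGroup G] (U : GaugeField P s G)
    (hflat : ∀ (x : Site P s) (w : List (Letter P.d)), (∀ ν, netDisp w ν = 0) → holAt U (walk x w) = 1) : wilsonAction4 U = 0 := by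
  unfold wilsonAction4 wilsonAction
  exact Finset.sum_eq_zero fun p _ => by rw [plaqHol_eq_one_of_holFlat U hflat p, GaugeGroup.reTr_one, sub_self, mul_zero]

/-- **TRIVIAL PLAQUETTES ⇒ ZERO COVARIANT DIVERGENCE** `(D^{1*}_U ∂U)_μ(x) = 0` (`SU(2)`, through the `AvgCurvGrad` dictionary `covDerivT_plaqFT_shift_eq`:
each term is `U⁻¹·1·U − 1 = 0`). [cite: Balaban1985RegularSpaces, (1.1)-(1.2) p.76] -/
theorem covDivT_eq_zero_of_plaqHol_eq_one (U : GaugeField P s (Matrix.specialUnitaryGroup (Fin 2) ℂ))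
    (h1 : ∀ p, GaugeField.plaqHol U p = 1) (μ : Fin P.d) (x : Site P s) : covDivT 1 (unitsField (toUField U)) μ x = 0 := by
  have hterm : ∀ {κ κ' : Fin P.d} (h : κ < κ') (ν : Fin P.d),
      covDerivT 1 (unitsField (toUField U)) ν (plaqFT (unitsField (toUField U)) κ κ') x = 0 := by
    intro κ κ' h ν
    rw [← Site.shift_unshift x ν, AvgCurvGrad.covDerivT_plaqFT_shift_eq U ν h, h1, h1, mul_one, inv_mul_cancel, sub_self]
  unfold covDivT
  rw [Finset.sum_eq_zero fun ν hν => hterm (Finset.mem_Iio.mp hν) ν, Finset.sum_eq_zero fun ν hν => hterm (Finset.mem_Ioi.mp hν) ν, sub_zero]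

variable (F : T3Family) {n K : ℕ}

/-- **A PLAQUETTE-TRIVIAL CONFIGURATION LIES IN PRINT'S REGULAR SPACE `𝔘_k(e)` FOR EVERY `e > 0`** (both clauses of (2)). [cite: Balaban1985Variational, (2) p.278] -/
theorem regPr_of_plaqHol_eq_one {e : ℝ} (he : 0 < e) {U : GaugeField (F.P K) 0 (Matrix.specialUnitaryGroup (Fin 2) ℂ)}
    (h1 : ∀ p, GaugeField.plaqHol U p = 1) : RegPr F n K e U := by
  refine ⟨fun p => by rw [h1 p, GaugeGroup.dist1_one]; exact regThreshold_pos F he, fun b => ?_⟩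
  rw [covDivT_eq_zero_of_plaqHol_eq_one U h1, norm_zero]
  have hL : (0 : ℝ) < (F.L : ℝ)⁻¹ := inv_pos.mpr (T3LowerAlongMinimisersSplit.L_cast_pos F)
  positivity

end FlatSU2

/-! ## §4 At the carrier: one orbit in the flat sector of a fibre; both clauses at every datum meeting the flat sector -/

section Carrier

variable (F : T3Family) {n K : ℕ} (h : n ≤ K)

/-- Two configurations in one fibre have the same `(K−n)`-fold (0.4) average on the `K`-th tower. [cite: Balaban1987RG1, (0.11) p.253] -/
theorem iter_eq_of_mem_fibre {G : Type*} [GaugeGroup G] (ℰ : LoopAverage G) {V : GaugeField (F.P n) 0 G} {U U' : GaugeField (F.P K) 0 G}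
    (hU : U ∈ fibre F ℰ n K h V) (hU' : U' ∈ fibre F ℰ n K h V) :
    Averaging.iter (fun i => blockAvg (P := F.P K) (j := i) ℰ) (K - n) U = Averaging.iter (fun i => blockAvg (P := F.P K) (j := i) ℰ) (K - n) U' := by
  have h1 : descendTo F ℰ n K h U = descendTo F ℰ n K h U' := hU.trans hU'.symm
  have h2 := congrArg (fieldShift (F.sitesPerDir_eq (m := F.m) (K := n) (j := 0) (m' := F.m) (K' := K) (j' := K - n) (by omega)).symm) h1
  unfold descendTo at h2
  rwa [fieldShift_fieldShift_symm, fieldShift_fieldShift_symm] at h2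

/-- **RIGIDITY OF THE FLAT SECTOR OF A FIBRE**: two holonomy-flat configurations in the same (0.4)-fibre lie on ONE orbit of print's group (4).
[cite: Balaban1985Variational, (4) p.278] -/
theorem sameOrbit_of_holFlat_of_mem_fibre {V : GaugeField (F.P n) 0 (Matrix.specialUnitaryGroup (Fin 2) ℂ)}
    {U U' : GaugeField (F.P K) 0 (Matrix.specialUnitaryGroup (Fin 2) ℂ)}
    (hflat : ∀ (x : Site (F.P K) 0) (w : List (Letter (F.P K).d)), (∀ ν, netDisp w ν = 0) → holAt U (walk x w) = 1)
    (hflat' : ∀ (x : Site (F.P K) 0) (w : List (Letter (F.P K).d)), (∀ ν, netDisp w ν = 0) → holAt U' (walk x w) = 1)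
    (hU : U ∈ fibre F ℰp n K h V) (hU' : U' ∈ fibre F ℰp n K h V) : T3Thm1Carrier.SameOrbit F n K h U U' := by
  have hk : K - n ≤ (F.P K).m + (F.P K).K := by show K - n ≤ F.m + K; omega
  have hseg : ∀ c : PBond (F.P K) (K - n),
      holAt U (walk (embIter (K - n) c.src) (List.replicate ((F.P K).L ^ (K - n)) (c.dir, true))) =
        holAt U' (walk (embIter (K - n) c.src) (List.replicate ((F.P K).L ^ (K - n)) (c.dir, true))) := fun c => by
    have h1 := congrFun (iter_eq_of_mem_fibre F h ℰp hU hU') c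
    rwa [iter_blockAvg_eq_straightIter_of_flat ℰp expMeanLogSU_E_one U hflat (K - n),
      iter_blockAvg_eq_straightIter_of_flat ℰp expMeanLogSU_E_one U' hflat' (K - n)] at h1
  obtain ⟨u, hu1, hu⟩ := exists_gaugeAct_eq_of_segments U U' hseg hk hflat hflat'
  refine ⟨u, ?_, hu.symm⟩
  funext x
  show transfUp u (K - n) _ = 1
  rw [transfUp_eq_embIter]
  exact hu1 _

/-- **A READING-R2 CRITICAL CONFIGURATION OVER A DATUM WHOSE FIBRE MEETS THE FLAT SECTOR IS HOLONOMY-FLAT**: it minimises over some (6)(e)(V), which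
contains the flat competitor (regular at every radius), so its action is `≤ 0`. [cite: Balaban1985Variational, (5)-(6) p.278] -/
theorem holFlat_of_isCritR2 {V : GaugeField (F.P n) 0 (Matrix.specialUnitaryGroup (Fin 2) ℂ)}
    {U₁ U : GaugeField (F.P K) 0 (Matrix.specialUnitaryGroup (Fin 2) ℂ)}
    (hflat₁ : ∀ (x : Site (F.P K) 0) (w : List (Letter (F.P K).d)), (∀ ν, netDisp w ν = 0) → holAt U₁ (walk x w) = 1)
    (hU₁ : U₁ ∈ fibre F ℰp n K h V) (hc : IsCritR2 F n K h V U) :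
    ∀ (x : Site (F.P K) 0) (w : List (Letter (F.P K).d)), (∀ ν, netDisp w ν = 0) → holAt U (walk x w) = 1 := by
  obtain ⟨e, he, -, hmin⟩ := hc
  have hA : wilsonAction4 U = 0 := by
    have h1 : wilsonAction4 U ≤ wilsonAction4 U₁ :=
      hmin ((mem_regFibrePr_iff F).mpr ⟨hU₁, regPr_of_plaqHol_eq_one F he (plaqHol_eq_one_of_holFlat U₁ hflat₁)⟩)
    rw [wilsonAction4_eq_zero_of_holFlat U₁ hflat₁] at h1
    exact le_antisymm h1 (wilsonAction4_nonneg U)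
  exact holFlat_of_plaqHol_eq_one U (plaqHol_eq_one_of_wilsonAction4_eq_zero U hA)

/-- **CLAUSE 1 OF [7] PROP. 7 AT EVERY DATUM WHOSE FIBRE MEETS THE FLAT SECTOR, FOR EVERY `ε₀`.** [cite: Balaban1985Variational, Prop. 7 p.299] -/
theorem atMostOneCriticalOrbit_of_holFlat_mem_fibre {L : ℕ} (i : Idx L) {V : GaugeField (i.1.1.P i.1.2.1) 0 (Matrix.specialUnitaryGroup (Fin 2) ℂ)}
    {U₁ : GaugeField (i.1.1.P i.1.2.2) 0 (Matrix.specialUnitaryGroup (Fin 2) ℂ)}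
    (hflat₁ : ∀ (x : Site (i.1.1.P i.1.2.2) 0) (w : List (Letter (i.1.1.P i.1.2.2).d)), (∀ ν, netDisp w ν = 0) → holAt U₁ (walk x w) = 1)
    (hU₁ : U₁ ∈ fibre i.1.1 ℰp i.1.2.1 i.1.2.2 i.2.2.le V) (ε₀ : ℝ) : (famX L i).AtMostOneCriticalOrbit ε₀ V := by
  obtain ⟨⟨F, n, K⟩, hF, hnK⟩ := i
  intro U U' _ _ hc _ _ hc'
  exact sameOrbit_of_holFlat_of_mem_fibre F hnK.le (holFlat_of_isCritR2 F hnK.le hflat₁ hU₁ hc) (holFlat_of_isCritR2 F hnK.le hflat₁ hU₁ hc')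
    (by obtain ⟨e, -, hUe, -⟩ := hc; exact ((mem_regFibrePr_iff F).mp hUe).1)
    (by obtain ⟨e, -, hUe, -⟩ := hc'; exact ((mem_regFibrePr_iff F).mp hUe).1)

/-- **CLAUSE 2 OF [7] PROP. 7 AT EVERY DATUM WHOSE FIBRE MEETS THE FLAT SECTOR, AT EVERY RADIUS `e > 0`**: the flat configuration itself lies in (6)(e)(V)
and minimises there (zero action). [cite: Balaban1985Variational, Prop. 7 p.299] -/
theorem onMinimalOrbit_of_holFlat_mem_fibre {L : ℕ} (i : Idx L) {V : GaugeField (i.1.1.P i.1.2.1) 0 (Matrix.specialUnitaryGroup (Fin 2) ℂ)}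
    {U₁ : GaugeField (i.1.1.P i.1.2.2) 0 (Matrix.specialUnitaryGroup (Fin 2) ℂ)}
    (hflat₁ : ∀ (x : Site (i.1.1.P i.1.2.2) 0) (w : List (Letter (i.1.1.P i.1.2.2).d)), (∀ ν, netDisp w ν = 0) → holAt U₁ (walk x w) = 1)
    (hU₁ : U₁ ∈ fibre i.1.1 ℰp i.1.2.1 i.1.2.2 i.2.2.le V) {e : ℝ} (he : 0 < e) : (famX L i).OnMinimalOrbit e V U₁ := by
  obtain ⟨⟨F, n, K⟩, hF, hnK⟩ := i
  refine ⟨(mem_regFibrePr_iff F).mpr ⟨hU₁, regPr_of_plaqHol_eq_one F he (plaqHol_eq_one_of_holFlat U₁ hflat₁)⟩, fun W _ => ?_⟩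
  show wilsonAction4 U₁ ≤ wilsonAction4 W
  rw [wilsonAction4_eq_zero_of_holFlat U₁ hflat₁]
  exact wilsonAction4_nonneg W

end Carrier

/-! ## §5 Example: constant abelian configurations `U(b) = h^{a(b.dir)}` and their data (arbitrary Polyakov phases) -/

section ConstAbelian

variable {P : Params} {s : ℕ} {G : Type*} [GaugeGroup G]

/-- The holonomy of the constant configuration `U(b) = h^{a(b.dir)}` along a walk is `h^{Σ_ν a_ν·netDisp_ν}`. [folklore] -/
theorem holAt_walk_constPow (h : G) (a : Fin P.d → ℤ) : ∀ (x : Site P s) (w : List (Letter P.d)),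
    holAt (fun b : PBond P s => h ^ a b.dir) (walk x w) = h ^ (∑ ν, a ν * netDisp w ν)
  | x, [] => by simp [walk, holAt_nil, netDisp]
  | x, (μ, true) :: w => by
    have hsum : ∑ ν, a ν * netDisp ((μ, true) :: w) ν = a μ + ∑ ν, a ν * netDisp w ν := by
      simp only [netDisp_cons, if_true, mul_add, Finset.sum_add_distrib, mul_ite, mul_one, mul_zero]
      rw [Finset.sum_ite_eq Finset.univ μ (fun ν => a ν), if_pos (Finset.mem_univ μ)]
    simp only [walk, holAt_cons, if_true]
    rw [holAt_walk_constPow h a (x.shift μ) w, hsum, zpow_add]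
  | x, (μ, false) :: w => by
    have hsum : ∑ ν, a ν * netDisp ((μ, false) :: w) ν = -a μ + ∑ ν, a ν * netDisp w ν := by
      simp only [netDisp_cons, Bool.false_eq_true, if_false, mul_add, Finset.sum_add_distrib, mul_ite, mul_neg, mul_one, mul_zero]
      rw [Finset.sum_ite_eq Finset.univ μ (fun ν => -a ν), if_pos (Finset.mem_univ μ)]
    simp only [walk, holAt_cons, Bool.false_eq_true, if_false]
    rw [holAt_walk_constPow h a (x.unshift μ) w, hsum, zpow_add, zpow_neg]

/-- Hence the constant configuration `U(b) = h^{a(b.dir)}` is holonomy-flat. [folklore] -/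
theorem holFlat_constPow (h : G) (a : Fin P.d → ℤ) (x : Site P s) (w : List (Letter P.d)) (hw : ∀ ν, netDisp w ν = 0) :
    holAt (fun b : PBond P s => h ^ a b.dir) (walk x w) = 1 := by
  rw [holAt_walk_constPow]
  simp [hw]

/-- **BOTH CLAUSES OF [7] PROP. 7 AT THE CONSTANT ABELIAN DATA `V = D_{n,K}(b ↦ h^{a(b.dir)})`** (every member, every `ε₀`, every radius `e > 0`;
`h ∈ SU(2)`, `a : Fin 3 → ℤ` arbitrary — data with Polyakov phases `h^{a_ν N₀}`, not pure gauge in general). [cite: Balaban1985Variational, Prop. 7 p.299] -/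
theorem prop7_clauses_constAbelianDatum {L : ℕ} (i : Idx L) (hh : Matrix.specialUnitaryGroup (Fin 2) ℂ) (a : Fin (i.1.1.P i.1.2.2).d → ℤ)
    (ε₀ e : ℝ) (he : 0 < e) :
    (famX L i).AtMostOneCriticalOrbit ε₀
        (descendTo i.1.1 ℰp i.1.2.1 i.1.2.2 i.2.2.le (fun b : PBond (i.1.1.P i.1.2.2) 0 => hh ^ a b.dir)) ∧
      (famX L i).OnMinimalOrbit e (descendTo i.1.1 ℰp i.1.2.1 i.1.2.2 i.2.2.le (fun b : PBond (i.1.1.P i.1.2.2) 0 => hh ^ a b.dir))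
        (fun b : PBond (i.1.1.P i.1.2.2) 0 => hh ^ a b.dir) :=
  ⟨atMostOneCriticalOrbit_of_holFlat_mem_fibre i (holFlat_constPow hh a) rfl ε₀,
    onMinimalOrbit_of_holFlat_mem_fibre i (holFlat_constPow hh a) rfl he⟩

end ConstAbelian

end Summit.QuantumFields.YangMills.Theorems.Prop7FlatRigidity

end
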